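import Summits.BirchSwinnertonDyer.Rank1Residual.X11b.BDPRouteDescent
import Literature.NumberTheory.EllipticCurves.Rank1Residual.X9NoEntry
import Literature.NumberTheory.EllipticCurves.Skinner2016.RankZeroPPart
import HarnessLib

/-!
# Class X11b, route "BDP + converse-theorem engine + Kolyvagin": the assembly on the class (cell `b2b-bsdres`, sub-cell `multr1-p2`)

HONEST FRAMING (cell `b2b-bsdres`, run/shared/lean/b2b/bsd-rank1-residual/, verbatim in every
file): the goal of the cell is to DELETE the COMBINATION-SHAPED residual classes of the
Birch–Swinnerton-Dyer formula for ALL analytic-rank `≤ 1` elliptic curves over `ℚ` — "full BSD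
formula for every rank `≤ 1` curve in class `C`" assembled STRICTLY from published theorems — so
that the rank-`≤ 1` remainder becomes exactly the CONSTRUCTION-SHAPED classes, which are TYPED
(missing-input `Prop`s), NOT attempted. This is not "finishing BSD". Sub-cell `multr1-p2` is a
RESEARCH ROUTE on class X11b (`ClassX11b W p := r_an = 1 ∧ p ≠ 2 ∧ mult(p) ∧ irr(p)`,
`Partition/Rows.lean`); no claim beyond the stated class and locus.

THEOREMS ONLY (no definition, no new named fact). `bsdp_of_classX11b_of_indexLowerBoundAt`: on the
locus of `X11b/BDPRoute.lean` — `ClassX11b W p`, `p ≥ 5`, `ram(p)` (⇒ `ρ̄_{E,p}` surjective,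
`surj_of_irr_of_ram`), `p ∤ ∏_ℓ c_ℓ(E/ℚ)` — with Heegner data, the rank-`0` `p`-part of the twist
from Skinner, Pacific J. Math. 283 (2016) Thm. C (tree fact `Skinner2016.thmC_padicValRat_bsd_rank_zero`;
its three hypotheses for the minimal model `Wd` of `E^{d_K}` kept as explicit binders: in print they
are inherited from `W` because `E^{d_K} ≅ E` over `ℚ_ℓ` at every `ℓ ∣ N`, all split in `K`; the
tree has this transport only for split multiplicative reduction,
`hasSplitMultiplicativeReductionAtPrime_quadraticTwist_iff`), and the typed input
`IndexLowerBoundAt` (STEP L, OPEN at `p ∥ N`) ⇒ `BSDp W p`, through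
`indexIdentityAt_of_lowerBound_of_kolyvagin` and `bsdp_of_indexIdentityAt` of
`X11b/BDPRouteDescent.lean`. What is NOT claimed: nothing here is a class theorem free of the typed
input; pairs of X11b with `p ∣ ∏_ℓ c_ℓ(E)` or without a (ram) prime are not reached by the route.

References: [JetchevSkinnerWan2017] §7.4 (pp. 30–31); [Skinner2016PacificMC] Thm. C;
[KolyvaginEulerSystems1990] Thm. A; [McCallumLMS1991] §1; [Miller2011LMS] Def. 1.1.
-/

noncomputable section

open scoped Classical

open WeierstrassCurve NumberField Literature.NumberTheory.EllipticCurves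
  Literature.NumberTheory.EllipticCurves.ModularForms
  Literature.NumberTheory.EllipticCurves.Rank1Residual
  Literature.NumberTheory.EllipticCurves.KrizLi2019

namespace Summit.BirchSwinnertonDyer.Rank1Residual.X11b


/-- **The route on class X11b (RESIDUAL-CASES §a.2 v5), on its locus, modulo its ONE typed input.**
Let `(E, p)` lie in X11b (`ClassX11b W p`: `ord_{s=1} L(E,s) = 1`, `p` odd, multiplicative
reduction at `p`, `E[p]` irreducible) and on the route's locus (`Locus W p`: `p ≥ 5`, a (ram) prime,
`p ∤ ∏_ℓ c_ℓ(E/ℚ)`). Fix Heegner data as in `bsdp_of_indexIdentityAt` (`K` imaginary quadratic with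
the Heegner hypothesis for the conductor `N` and `L(E^{d_K},1) ≠ 0`, `P` the Heegner point of a datum
`Dt` with `p ∤ c(Dt)`, `p ∤ #𝓞_K^×`, a minimal model `Wd = Cd • W^{(d_K)}` with the two decidable side
conditions) and the three hypotheses of Skinner 2016 Thm. C for `Wd` at `p` (multiplicative at `p`,
`Wd[p]` irreducible, (ram) — in print inherited from `W` because `E^{d_K} ≅ E` over `ℚ_ℓ` at every
`ℓ ∣ N`, all split in `K`; explicit binders here). PUBLISHED inputs (tree named facts, binders):
Gross–Zagier (`hGZ`), Kolyvagin 1990 Thm. A (`hKo`, `hB`), Skinner 2016 Thm. C (`hSk`),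
Gross–Zagier–Kolyvagin over `ℚ` (`hGZK`), modularity (`hmod`); `ρ̄_{E,p}` surjective is DERIVED
(`surj_of_irr_of_ram`). THE TYPED INPUT: `IndexLowerBoundAt W p K P` (STEP L; OPEN at `p ∥ N`, see
`X11b/BDPRoute.lean`). CONCLUSION: Miller's `BSD(E,p)`. Chain: STEP L + Kolyvagin ⇒ identity over
`K` (`indexIdentityAt_of_lowerBound_of_kolyvagin`) ⇒ descent (`bsdp_of_indexIdentityAt`, the twist's
rank-`0` `p`-part supplied by Skinner's Thm. C). This is a CONDITIONAL theorem: X11b stays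
CONSTRUCTION-SHAPED; what it records is that on this locus the class hinges on STEP L alone.
[cite: JetchevSkinnerWan2017, §7.4 (pp. 30–31)] [cite: Skinner2016PacificMC, Thm. C (§1)]
[cite: McCallumLMS1991, §1 Theorem (Kolyvagin), p. 296] [cite: Miller2011LMS, Def. 1.1] -/
theorem bsdp_of_classX11b_of_indexLowerBoundAt
    (W : WeierstrassCurve ℚ) [W.IsElliptic] [W.IsGloballyMinimal] (p : ℕ) [Fact p.Prime]
    (N : ℕ) [NeZero N] (K : Type) [Field K] [NumberField K]
    (Dt : ModularParametrizationData W N) (H : HeegnerDatum N (NumberField.discr K)) (ι : K →+* ℂ)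
    (P : (W.baseChange K).toAffine.Point)
    -- the published inputs (named facts of the tree)
    (hGZ : gross_zagier N W K) (hKo : kolyvagin N W K)
    (hB : Kolyvagin1990_padicValNat_card_sha_le N W K)
    (hSk : Skinner2016.thmC_padicValRat_bsd_rank_zero)
    (hGZK : rank_eq_analyticRank_of_analyticRank_le_one) (hmod : hasEntireLFunction_rat)
    -- the class and the locus
    (hX : ClassX11b W p) (hloc : Locus W p)
    -- the Heegner data
    (hK : IsImaginaryQuadratic K) (hHN : SatisfiesHeegnerHypothesis N K)
    (hP : WeierstrassCurve.Affine.Point.map ι.toRatAlgHom P = heegnerPointComplex Dt H)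
    (hc : ¬ (p : ℤ) ∣ Dt.c) (hμ : ¬ p ∣ Units.torsionOrder K)
    (hLt : (W.quadraticTwist (NumberField.discr K : ℚ)).entireLFunction 1 ≠ 0)
    -- a globally minimal model of the twist, Skinner's hypotheses for it, and the side conditions
    (Wd : WeierstrassCurve ℚ) [Wd.IsElliptic] [Wd.IsGloballyMinimal] (Cd : VariableChange ℚ)
    (hWd : Cd • W.quadraticTwist (NumberField.discr K : ℚ) = Wd)
    (hmultd : Wd.HasMultiplicativeReductionAtPrime p) (hirrd : Wd.HasIrreducibleModPGaloisRep p)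
    (hramd : Ram Wd p)
    (htam : padicValNat p Wd.tamagawaProduct = padicValNat p W.tamagawaProduct)
    (hu : padicValRat p (Cd.u : ℚ) = 0)
    -- the typed input of the route (STEP L)
    (hL : IndexLowerBoundAt W p K P) : BSDp W p := by
  obtain ⟨hr, -, -, hirr⟩ := hX
  obtain ⟨hp5, hram, htam0⟩ := hloc
  have hp2 : p ≠ 2 := by omega
  have hp3 : 3 ≤ p := by omega
  have hD0 : (NumberField.discr K : ℚ) ≠ 0 := by exact_mod_cast NumberField.discr_ne_zero K
  haveI hEt : (W.quadraticTwist (NumberField.discr K : ℚ)).IsElliptic :=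
    W.isElliptic_quadraticTwist hD0
  -- `ρ̄_{E,p}` is surjective (irr + ram)
  have hsurj : Surj W p := surj_of_irr_of_ram W p hirr hram
  -- the Heegner point has infinite order (Gross–Zagier, `L'(E,1) ≠ 0`, `L(E^D,1) ≠ 0`)
  have hL0 : W.entireLFunction 1 = 0 := entireLFunction_one_eq_zero_of_analyticRank_eq_one hr
  obtain ⟨-, hderiv⟩ := leadingLCoeff_eq_deriv_of_analyticRank_eq_one hr
  have hLK : LDerivEK W K ≠ 0 := by
    rw [lDerivEK_eq_deriv_mul W K hmod hL0]; exact mul_ne_zero hderiv hLt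
  have hPH : IsHeegnerPoint N W K P := ⟨Dt, H, ι, hP⟩
  have hPinf : ¬ IsOfFinAddOrder P :=
    (lDerivEK_ne_zero_iff_not_isOfFinAddOrder W N K hGZ hK hHN hPH).mp hLK
  -- STEP L + STEP U ⇒ the identity over `K`
  have hid : Finite (W.baseChange K).sha → IndexIdentityAt W p K P := fun _ =>
    indexIdentityAt_of_lowerBound_of_kolyvagin W p hB hK hHN hPH hPinf hp2 hsurj htam0 hL
  -- the twist: analytic rank `0`, finiteness, and Skinner's Thm. C
  have hLt' : (W.quadraticTwist (NumberField.discr K : ℚ)).entireLFunction = Wd.entireLFunction := by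
    rw [← hWd, entireLFunction_smul]
  have hLd1 : Wd.entireLFunction 1 ≠ 0 := by rw [← hLt']; exact hLt
  have hrd : Wd.analyticRank = 0 := (Wd.analyticRank_eq_zero_iff_holds (hmod Wd)).2 hLd1
  have hfinSd : Finite Wd.sha := (hGZK Wd (by omega)).2
  have htw := hSk Wd p hp3 (Or.inr hmultd) hirrd hramd hLd1 hfinSd
  exact bsdp_of_indexIdentityAt W p N K Dt H ι P hGZ hKo hGZK hmod hK hHN hP hp2 hc hμ hr hLt Wd Cd
    hWd htw htam hu hid

end Summit.BirchSwinnertonDyer.Rank1Residual.X11b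

end
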